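import Summits.ResolutionOfSingularities.ResolutionOfSingularities.Theorems.PurelyInseparableDim4ChartAtlasShearedMember
import HarnessLib

/-!
# Purely inseparable four-folds `z^p + F(x₁, …, x₄)`: the dictionary for boundary members MISSING THE WALK'S POINT — their strict transform
# reads the total transform `ψ_t(f)·𝒪` on every chart; far quadrics become CUBICS under the next blow-up (S3-N2 support; typ-2 g6)

[OURS · counted 0] (D-0157 DOOR 2; DR-157-C; desk WORD #115 (a); typ-2 g5 «HEIGHT RULE for older far members: no closed form — track the member's
polynomial»; crit-3's censusA). p696894's engine reads the strict transform of a principal member `f·𝒪` on the chart `x_t` of a blowing up of `𝔸⁵`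
along `V(z, x_S)` as `g·𝒪` whenever `ψ_t f = x_t^k · g`, `x_t ∤ g`. For a member that does NOT pass through the origin of the current chart (the walk's
point) — every FAR member at every depth — `k = 0`: PROVED here (no `sorry`, no new axiom)

* `constantCoeff_coordBlowupSubst` — the chart substitution `ψ_t` preserves constant terms (every field, every `n`);
* **`strictTransformIdeal_comap_chartImm_of_constantCoeff_ne_zero`** — `f(0) ≠ 0` ⟹ `St_π(f·𝒪)` reads `(ψ_t f)·𝒪` on the chart `x_t`, `t ∈ S`, for ANY
  blowing up `π` along `V(z, x_S)` (then re-centre by the next shear/translation, p687523/p696282);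
* `coordBlowupSubst_far_quadric` / `coordBlowupSubst_far_quadric_of_mem` — the worked instances: a far quadric `((yᵢ + bᵢ)·y_j + dᵢ)·𝒪` of the
  `x_j`-chart (p699206) under the NEXT blow-up along `V(y_0, y_{S'})` reads on the chart `y_t` (`t ∈ S'`): the SAME quadric shape when `i ∉ S' ∖ {t}`
  and `j ∉ S'`, but the CUBIC `((yᵢ·y_t + bᵢ)·y_j + dᵢ)·𝒪` when `i ∈ S' ∖ {t}`, `j ∉ S'` — the far alphabet {translated hyperplane, `(y y' + d)`,
  `((y + b) y' + d)`, `((y + b y') y'' + d)`} is NOT closed under the walk: the degree grows by one at every later step whose centre contains `yᵢ` but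
  not `y_j` (kernel form of g5's «no closed-form height»; where the planner's cost rider r5 recurs for far members).

Nothing here is a statement about resolution of singularities in dimension ≥ 4 / characteristic `p` (NOT proved anywhere in this programme).
bears_on: LADDER-RESOLUTION:D157-DOOR2 (res-dim4-pi). Supports stmt-ResolutionOfSingularities-16155 (helper, S3-N2 dictionary).
-/

-- every declaration of this summit lives under `Summit.ResolutionOfSingularities.ResolutionOfSingularities`
-- (summit = problem), which the duplicate-namespace linter flags; house convention (cf. the Target file).
set_option linter.dupNamespace false

noncomputable section

open MvPolynomial CategoryTheory AlgebraicGeometry Opposite TopologicalSpace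
open AlgebraicGeometry.Scheme.IdealSheafData (ofIdealTop)

namespace Summit.ResolutionOfSingularities.ResolutionOfSingularities.Theorems.PIDim4

open Literature.AlgebraicGeometry.Resolution
open Literature.AlgebraicGeometry.Resolution.AffinePointBlowup (P A γ coord Wtop ξ)

namespace ChartDictionary

/-! ## §1 The chart substitution preserves constant terms -/

/-- **The chart substitution `ψ_{i₀}` (`yᵢ ↦ y_{i₀}·yᵢ` on the centre variables `i ≠ i₀`) preserves constant terms.** -/
theorem constantCoeff_coordBlowupSubst {R : Type} [CommRing R] {σ : Type} (Λ : Set σ) (i₀ : σ) (f : MvPolynomial σ R) :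
    constantCoeff (coordBlowupSubst R Λ i₀ f) = constantCoeff f := by
  classical
  have h : (constantCoeff : MvPolynomial σ R →+* R).comp (coordBlowupSubst R Λ i₀ : MvPolynomial σ R →+* MvPolynomial σ R) =
      constantCoeff := by
    refine ringHom_ext (fun r => ?_) (fun i => ?_)
    · rw [RingHom.comp_apply, RingHom.coe_coe, coordBlowupSubst_C]
    · rw [RingHom.comp_apply, RingHom.coe_coe, coordBlowupSubst_X]
      split_ifs
      · rw [map_mul, constantCoeff_X, constantCoeff_X, mul_zero]
      · rfl
  exact congrFun (congrArg DFunLike.coe h) f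

variable {K : Type} [Field K] {S : Finset (Fin 4)} {t : Fin 4} {W : Scheme.{0}} {π : W ⟶ P 4 K}

/-- A polynomial with non-zero constant term is not divisible by a variable (in global sections of `𝔸⁵`). -/
theorem not_coord_dvd_γ_symm_of_constantCoeff_ne_zero (k : Fin (4 + 1)) {g : A 4 K} (hg : constantCoeff g ≠ 0) :
    ¬ coord 4 K k ∣ (γ 4 K).symm g :=
  not_coord_dvd_γ_symm_of_coeff 0 rfl (by rwa [← constantCoeff_eq])

/-! ## §2 Members missing the walk's point read their total transform -/

/-- **THE DICTIONARY FOR MEMBERS MISSING THE WALK'S POINT.** For ANY blowing up `π : W → 𝔸⁵` along `V(z, x_S)`, `t ∈ S`, and a principal member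
`f·𝒪` with `f(0) ≠ 0` (the member misses the origin of the chart — every far member, at every depth): `St_π(f·𝒪)` reads `(ψ_t f)·𝒪` on the chart
`x_t` (the strict transform is the total transform: `x_t ∤ ψ_t f` because `ψ_t` keeps the constant term). -/
theorem strictTransformIdeal_comap_chartImm_of_constantCoeff_ne_zero (ht : t ∈ S) {f : A 4 K} (hf : constantCoeff f ≠ 0)
    (hπ : IsBlowup π (AffineCoordBlowup.𝓘Λ 4 K (insert 0 (Fin.succ '' (S : Set (Fin 4)))))) :
    (strictTransformIdeal π (AffineCoordBlowup.𝓘Λ 4 K (insert 0 (Fin.succ '' (S : Set (Fin 4)))))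
        (ofIdealTop (Ideal.span {(γ 4 K).symm f}))).comap (AffineCoordBlowup.chartImm hπ (succ_mem_centreVars ht)) =
      ofIdealTop (Ideal.span {(γ 4 K).symm (coordBlowupSubst K (insert 0 (Fin.succ '' (S : Set (Fin 4)))) t.succ f)}) := by
  refine strictTransformIdeal_principal_comap_chartImm ht 0 (by rw [pow_zero, one_mul]) ?_ hπ
  exact not_coord_dvd_γ_symm_of_constantCoeff_ne_zero _ (by rwa [constantCoeff_coordBlowupSubst])

/-- The same behind a re-centring automorphism `Θ` of the chart (shear or translation of the S3-N1 atlas): the member reads `Θ(ψ_t f)·𝒪`. -/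
theorem comap_recenter_chart_strictTransform_of_constantCoeff_ne_zero (ht : t ∈ S) {f : A 4 K} (hf : constantCoeff f ≠ 0)
    (Θ : A 4 K ≃ₐ[K] A 4 K) (hπ : IsBlowup π (AffineCoordBlowup.𝓘Λ 4 K (insert 0 (Fin.succ '' (S : Set (Fin 4)))))) :
    (strictTransformIdeal π (AffineCoordBlowup.𝓘Λ 4 K (insert 0 (Fin.succ '' (S : Set (Fin 4)))))
        (ofIdealTop (Ideal.span {(γ 4 K).symm f}))).comap
        (Spec.map (CommRingCat.ofHom (Θ : A 4 K →+* A 4 K)) ≫ AffineCoordBlowup.chartImm hπ (succ_mem_centreVars ht)) =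
      ofIdealTop (Ideal.span {(γ 4 K).symm (Θ (coordBlowupSubst K (insert 0 (Fin.succ '' (S : Set (Fin 4)))) t.succ f))}) := by
  rw [Scheme.IdealSheafData.comap_comp, strictTransformIdeal_comap_chartImm_of_constantCoeff_ne_zero ht hf hπ, comap_ofIdealTop_span_γ_symm,
    RingHom.coe_coe]

/-! ## §3 Worked instances: a far quadric under the next blow-up -/

variable {S' : Finset (Fin 4)} {i j : Fin 4} {b d : K}

/-- **A far quadric stays a quadric** on the chart `y_t` of the next blow-up along `V(y_0, y_{S'})` when neither `yᵢ` (unless `i = t`) nor `y_j` is a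
centre variable: `ψ_t(((yᵢ + b)·y_j + d)) = (yᵢ + b)·y_j + d` for `i ∉ S'`, `j ∉ S'`. -/
theorem coordBlowupSubst_far_quadric (hi : i ∉ S') (hj : j ∉ S') :
    coordBlowupSubst K (insert 0 (Fin.succ '' (S' : Set (Fin 4)))) t.succ ((X i.succ + C b) * X j.succ + C d : A 4 K) =
      (X i.succ + C b) * X j.succ + C d := by
  rw [map_add, map_mul, map_add, coordBlowupSubst_C, coordBlowupSubst_C,
    coordBlowupSubst_X_of_not_mem K _ t.succ (fun h => hi ((succ_mem_centreVars_iff S' i).mp h)),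
    coordBlowupSubst_X_of_not_mem K _ t.succ (fun h => hj ((succ_mem_centreVars_iff S' j).mp h))]

/-- **A far quadric becomes a CUBIC** on the chart `y_t` of the next blow-up along `V(y_0, y_{S'})` when `yᵢ` is a centre variable other than `y_t`
and `y_j` is not: `ψ_t(((yᵢ + b)·y_j + d)) = (yᵢ·y_t + b)·y_j + d` (`i ∈ S' ∖ {t}`, `j ∉ S'`) — constant term still `d`, so by §2 this IS the reading of
the strict transform; the far alphabet is not closed under the walk. -/
theorem coordBlowupSubst_far_quadric_of_mem (hi : i ∈ S') (hit : i ≠ t) (hj : j ∉ S') :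
    coordBlowupSubst K (insert 0 (Fin.succ '' (S' : Set (Fin 4)))) t.succ ((X i.succ + C b) * X j.succ + C d : A 4 K) =
      (X i.succ * X t.succ + C b) * X j.succ + C d := by
  rw [map_add, map_mul, map_add, coordBlowupSubst_C, coordBlowupSubst_C,
    coordBlowupSubst_X_of_mem_of_ne K _ t.succ (succ_mem_centreVars hi) (fun e => hit (Fin.succ_injective _ e)),
    coordBlowupSubst_X_of_not_mem K _ t.succ (fun h => hj ((succ_mem_centreVars_iff S' j).mp h)), mul_comm (X t.succ)]

/-- **The reading itself**: for ANY blowing up `π'` of `𝔸⁵` along `V(y_0, y_{S'})` and `t ∈ S'`, the strict transform of the far quadric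
`((yᵢ + b)·y_j + d)·𝒪` (`d ≠ 0`, `i ∈ S' ∖ {t}`, `j ∉ S'`) reads the cubic `((yᵢ·y_t + b)·y_j + d)·𝒪` on the chart `y_t`. -/
theorem strictTransformIdeal_far_quadric_comap_chartImm {π' : W ⟶ P 4 K} (ht : t ∈ S') (hi : i ∈ S') (hit : i ≠ t) (hj : j ∉ S') (hd : d ≠ 0)
    (hπ' : IsBlowup π' (AffineCoordBlowup.𝓘Λ 4 K (insert 0 (Fin.succ '' (S' : Set (Fin 4)))))) :
    (strictTransformIdeal π' (AffineCoordBlowup.𝓘Λ 4 K (insert 0 (Fin.succ '' (S' : Set (Fin 4)))))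
        (ofIdealTop (Ideal.span {(γ 4 K).symm ((X i.succ + C b) * X j.succ + C d)}))).comap
        (AffineCoordBlowup.chartImm hπ' (succ_mem_centreVars ht)) =
      ofIdealTop (Ideal.span {(γ 4 K).symm ((X i.succ * X t.succ + C b) * X j.succ + C d)}) := by
  rw [strictTransformIdeal_comap_chartImm_of_constantCoeff_ne_zero ht ?_ hπ', coordBlowupSubst_far_quadric_of_mem hi hit hj]
  simp only [map_add, map_mul, constantCoeff_X, constantCoeff_C, zero_add, mul_zero]
  exact hd

end ChartDictionary

end Summit.ResolutionOfSingularities.ResolutionOfSingularities.Theorems.PIDim4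

end
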